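import Summits.AnomalousDissipation.AnomalousDissipation.Theses.WazewskiBlock
import Literature.Dynamics.ConleyIndex.WazewskiPrinciple

/-!
# `WazewskiRetract` — Ważewski's retract principle for continuous semiflows

Closes item `stmt-AnomalousDissipation-1736` (support decl `WazewskiRetract` of route
`AnomalousDissipation/WazewskiBlock`): for a continuous semiflow `φ` on a topological space, a closed
set `W` whose immediate-exit set `W⁻` is closed and is not a retract of `W` contains a point whose
forward orbit stays in `W`.  This is exactly
`Literature.Dynamics.ConleyIndex.IsSemiflow.exists_forall_mem_of_not_retract`
([Conley1976, §1, Thm. 1.3]; Wazewski1947), whose `immediateExitSet φ W` is by definition the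
inline set `{x | x ∈ W ∧ ∀ δ > 0, ∃ t ∈ Ioo 0 δ, φ t x ∉ W}` of the route decl.
-/

-- `Summit.<Summit>.<Problem>` is the tree's mandated summit-side namespace (CONVENTIONS §2); for this
-- single-conjunct summit the two coincide, so the duplicate is deliberate.
set_option linter.dupNamespace false

namespace Summit.AnomalousDissipation.AnomalousDissipation.Theorems

open Literature.Dynamics.ConleyIndex

/-- **Ważewski's retract principle** (route decl `WazewskiBlock.WazewskiRetract`): if `φ` is a
continuous semiflow, `W` is closed, its immediate-exit set `W⁻` is closed, and there is no
retraction of `W` onto `W⁻`, then some `x ∈ W` has `φ t x ∈ W` for all `t ≥ 0`.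
Proof: package the three flow hypotheses as `IsSemiflow φ` and apply
`IsSemiflow.exists_forall_mem_of_not_retract`. -/
theorem WazewskiRetract_proof :
    Summit.AnomalousDissipation.AnomalousDissipation.Theses.WazewskiBlock.WazewskiRetract := by
  unfold Summit.AnomalousDissipation.AnomalousDissipation.Theses.WazewskiBlock.WazewskiRetract
  intro X _ φ hcont h0 hadd W hW hmc hnr
  exact (IsSemiflow.mk hcont h0 hadd).exists_forall_mem_of_not_retract hW hmc hnr

end Summit.AnomalousDissipation.AnomalousDissipation.Theorems
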